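import Literature.NumberTheory.LFunctions.NymanBeurlingRate
import Literature.NumberTheory.LFunctions.NymanBeurlingProofs
import HarnessLib

/-!
# Balazard–de Roton 2010, Théorème 1: Proposition 1 and the reduction to Propositions 2 and 3

Companion of `Literature/NumberTheory/LFunctions/NymanBeurlingRate.lean` (named fact
`Literature.NumberTheory.LFunctions.BalazardDeRoton2010_thm1`: under RH,
`d_N² ≪_δ (log log N)^{5/2+δ}(log N)^{-1/2}`). Proved here, from M. Balazard, A. de Roton,
*Sur un critère de Báez-Duarte pour l'hypothèse de Riemann*, Int. J. Number Theory 6 (2010)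
883–903 = arXiv:0812.1689, §2:

* **Proposition 1** (p. 3, unconditional): with `M_N(s) = ∑_{n≤N} μ(n) n^{-s}`, `s = 1/2 + iτ`,
  `ν_{N,ε} := ‖χ + ∑_{n≤N} μ(n) n^{-ε} e_n‖²_H ≤ 2 I_{N,ε} + 2 J_ε`,
  `I_{N,ε} = (1/2π)∫ |ζ(s)|²|M_N(s+ε) - ζ(s+ε)⁻¹|² dτ/|s|²`, `J_ε = (1/2π)∫ |ζ(s)/ζ(s+ε) - 1|² dτ/|s|²`
  (Mellin–Plancherel `H ≅ L²(1/2+iℝ, dτ/2π)`, `𝔐e_n(s) = -n^{-s}ζ(s)/s`, `𝔐χ(s) = 1/s`,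
  `|a+b|² ≤ 2|a|²+2|b|²`) — `BalazardDeRoton.baezDuarteDistSqOf_coeff_le`, in lower-integral form;
* **the assembly** "Prop. 2 (HR: `J_ε ≪ ε`) + Prop. 3 (HR: `I_{N,ε} ≪ N^{-ε/2}` for `N ≥ N₀(δ)`,
  `ε ≥ 25(log log N)^{5/2+δ}(log N)^{-1/2}`) ⇒ Théorème 1" (p. 3: "Le choix
  `ε = 25(log log N)^{5/2+δ}(log N)^{-1/2}` donne le théorème") —
  `BalazardDeRoton2010_thm1_of_props`, with Propositions 2 and 3 as explicit hypotheses.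

Vocabulary: the `x = 1/t` picture of `NymanBeurlingRate.lean`/`NymanBeurlingProofs.lean`
(`H = L²(0,∞;t⁻²dt) ↦ L²((0,∞),dx)`, `χ ↦ 𝟙_{(0,1]}`, `e_n ↦ {1/(nx)}`);
`χ + ∑_{n≤N} μ(n)n^{-ε}e_n` is `BaezDuarteOnlyIf.approx (coeff (ε/2) N)` (`c_k = -μ(k+1)(k+1)^{-ε}`),
its square integral is `baezDuarteDistSqOf N (coeff (ε/2) N)`; Plancherel at abscissa `1/2` and
`𝔐[approx c](w) = (1 - ζ(w)M_N(w+ε))/w` are the tree's `plancherel_approxC` (`ε := 0`),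
`mellin_approxC_eq`, `dirichletPoly_coeff`. Propositions 2 and 3 themselves (Hadamard product and
residues; Soundararajan's method for `M(x)` and the twisted sums `M_N(iτ)`) are NOT in this file.

## References

* [BalazardDeRoton2010] M. Balazard, A. de Roton, Int. J. Number Theory 6 (2010) 883–903,
  Prop. 1, Props. 2–3 and the choice of `ε` (p. 3), Théorème 1 (p. 2); arXiv:0812.1689.
* [BaezDuarte2003] L. Báez-Duarte, Rend. Lincei 14 (2003) 5–11, §2.2 (the same Mellin set-up).
-/


noncomputable section

open Complex Filter Asymptotics MeasureTheory Set
open scoped Real Topology ENNReal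

namespace Literature.NumberTheory.LFunctions

namespace BalazardDeRoton

open BaezDuarteOnlyIf

/-! ## The integrands of `J_ε` and `I_{N,ε}` -/

/-- The integrand of `2π J_ε`: `|1 - ζ(s)/ζ(s+ε)|² / |s|²` at `s = 1/2 + iτ`
(`J_ε = (1/2π)∫ |ζ(s)/ζ(s+ε) - 1|² dτ/|s|²`). [cite: BalazardDeRoton2010, Prop. 1] -/
def jIntegrand (ε τ : ℝ) : ℝ :=
  ‖1 - riemannZeta (1 / 2 + τ * I) / riemannZeta (1 / 2 + ε + τ * I)‖ ^ 2 /
    ‖(1 / 2 + τ * I : ℂ)‖ ^ 2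

/-- The integrand of `2π I_{N,ε}`: `|ζ(s)|² |M_N(s+ε) - ζ(s+ε)⁻¹|² / |s|²` at `s = 1/2 + iτ`, with
`M_N(w) = ∑_{n≤N} μ(n) n^{-w}` (`BaezDuarteOnlyIf.moebiusSum N w`)
(`I_{N,ε} = (1/2π)∫ |ζ(s)|²|M_N(s+ε) - ζ(s+ε)⁻¹|² dτ/|s|²`). [cite: BalazardDeRoton2010, Prop. 1] -/
def iIntegrand (N : ℕ) (ε τ : ℝ) : ℝ :=
  ‖riemannZeta (1 / 2 + τ * I)‖ ^ 2 *
      ‖moebiusSum N (1 / 2 + ε + τ * I) - (riemannZeta (1 / 2 + ε + τ * I))⁻¹‖ ^ 2 /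
    ‖(1 / 2 + τ * I : ℂ)‖ ^ 2

/-- `jIntegrand ε τ ≥ 0`. [folklore] -/
lemma jIntegrand_nonneg (ε τ : ℝ) : 0 ≤ jIntegrand ε τ := by
  unfold jIntegrand; positivity

/-- `iIntegrand N ε τ ≥ 0`. [folklore] -/
lemma iIntegrand_nonneg (N : ℕ) (ε τ : ℝ) : 0 ≤ iIntegrand N ε τ := by
  unfold iIntegrand; positivity

/-- `jIntegrand ε` is measurable (`ζ` is measurable). [folklore] -/
lemma measurable_jIntegrand (ε : ℝ) : Measurable (jIntegrand ε) := by
  unfold jIntegrand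
  have h1 : Measurable fun τ : ℝ ↦ riemannZeta (1 / 2 + τ * I) :=
    measurable_riemannZeta.comp (by fun_prop)
  have h2 : Measurable fun τ : ℝ ↦ riemannZeta (1 / 2 + ε + τ * I) :=
    measurable_riemannZeta.comp (by fun_prop)
  exact ((measurable_const.sub (h1.div h2)).norm.pow_const 2).div
    ((by fun_prop : Measurable fun τ : ℝ ↦ (1 / 2 + τ * I : ℂ)).norm.pow_const 2)

/-! ## Proposition 1 -/

/-- **Proposition 1, pointwise form.** For the coefficients `c_k = -μ(k+1)(k+1)^{-ε}`
(`coeff (ε/2) N`), the Mellin transform of `χ + ∑_{n≤N} μ(n)n^{-ε}e_n` on the critical line is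
`(1 - ζ(s)M_N(s+ε))/s`, and `|1 - ζ(s)M_N(s+ε)|²/|s|² ≤ 2·jIntegrand + 2·iIntegrand`
(write `1 - ζM_N = (1 - ζ/ζ_ε) + ζ(ζ_ε⁻¹ - M_N)`, `|a+b|² ≤ 2|a|²+2|b|²`).
[cite: BalazardDeRoton2010, Prop. 1 (proof)] -/
theorem norm_sq_mellin_approxC_coeff_le (N : ℕ) (ε τ : ℝ) :
    ‖mellin (approxC (coeff (ε / 2) N)) (((1 / 2 : ℝ) : ℂ) + τ * I)‖ ^ 2 ≤
      2 * jIntegrand ε τ + 2 * iIntegrand N ε τ := by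
  have hw : (((1 / 2 : ℝ) : ℂ) + τ * I) = (1 / 2 + τ * I : ℂ) := by push_cast; ring
  have hre : (1 / 2 + τ * I : ℂ).re = 1 / 2 := by simp
  rw [hw, mellin_approxC_eq _ (by rw [hre]; norm_num) (by rw [hre]; norm_num), dirichletPoly_coeff,
    show (1 / 2 + τ * I : ℂ) + 2 * ((ε / 2 : ℝ) : ℂ) = 1 / 2 + ε + τ * I by push_cast; ring]
  unfold jIntegrand iIntegrand
  exact norm_sq_div_le _ _ _ _

/-- The squared distance `baezDuarteDistSqOf N c` is the lower integral of `(approx c)²`.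
[folklore] -/
lemma baezDuarteDistSqOf_eq_lintegral_approx (N : ℕ) (c : Fin N → ℝ) :
    baezDuarteDistSqOf N c = ∫⁻ x in Ioi (0 : ℝ), ENNReal.ofReal (approx c x ^ 2) := rfl

/-- `baezDuarteDistSqOf N c = ofReal (∫_0^∞ (approx c)²)` (the integrand is integrable).
[folklore] -/
lemma baezDuarteDistSqOf_eq_ofReal_integral (N : ℕ) (c : Fin N → ℝ) :
    baezDuarteDistSqOf N c = ENNReal.ofReal (∫ x in Ioi (0 : ℝ), approx c x ^ 2) := by
  rw [baezDuarteDistSqOf_eq_lintegral_approx,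
    ofReal_integral_eq_lintegral_ofReal (integrableOn_sq_approx c)
      (ae_of_all _ fun x ↦ sq_nonneg _)]

/-- **Mellin–Plancherel at abscissa `1/2`** for the approximant:
`∫_0^∞ (approx c)² = (2π)⁻¹ ∫ |𝔐[approx c](1/2+iτ)|² dτ`, and the right-hand integrand is
integrable. [cite: BalazardDeRoton2010, §2 (Plancherel, `H ≅ L²(1/2+iℝ, dτ/2π)`)] -/
lemma integral_sq_approx_eq (N : ℕ) (c : Fin N → ℝ) :
    Integrable (fun τ : ℝ ↦ ‖mellin (approxC c) (((1 / 2 : ℝ) : ℂ) + τ * I)‖ ^ 2) ∧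
    ∫ x in Ioi (0 : ℝ), approx c x ^ 2 =
      (2 * π)⁻¹ * ∫ τ : ℝ, ‖mellin (approxC c) (((1 / 2 : ℝ) : ℂ) + τ * I)‖ ^ 2 := by
  have h := plancherel_approxC (ε := 0) le_rfl (by norm_num) c
  simp only [sub_zero] at h
  refine ⟨h.1, ?_⟩
  rw [h.2, ← mul_assoc, inv_mul_cancel₀ (by positivity), one_mul]
  refine setIntegral_congr_fun measurableSet_Ioi fun x _ ↦ ?_
  rw [show (2 * (1 / 2 : ℝ) - 1) = 0 by norm_num, Real.rpow_zero, mul_one, norm_approxC, sq_abs]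

/-- **Proposition 1** (Balazard–de Roton 2010, p. 3, unconditional):
`ν_{N,ε} ≤ 2 I_{N,ε} + 2 J_ε`, in the tree's vocabulary:
`baezDuarteDistSqOf N (coeff (ε/2) N) ≤ π⁻¹ (∫jIntegrand + ∫iIntegrand)` (recall
`J_ε = (2π)⁻¹∫jIntegrand`, `I_{N,ε} = (2π)⁻¹∫iIntegrand`) as an inequality of lower Lebesgue
integrals ("les quantités `I_{N,ε}` et `J_ε` pourraient être infinies", p. 3 — no finiteness is
assumed). [cite: BalazardDeRoton2010, Prop. 1] -/
theorem baezDuarteDistSqOf_coeff_le (N : ℕ) (ε : ℝ) :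
    baezDuarteDistSqOf N (coeff (ε / 2) N) ≤
      ENNReal.ofReal (π⁻¹) *
        ((∫⁻ τ : ℝ, ENNReal.ofReal (jIntegrand ε τ)) +
          ∫⁻ τ : ℝ, ENNReal.ofReal (iIntegrand N ε τ)) := by
  set c := coeff (ε / 2) N with hc
  obtain ⟨hint, heq⟩ := integral_sq_approx_eq N c
  rw [baezDuarteDistSqOf_eq_ofReal_integral, heq, ENNReal.ofReal_mul (by positivity),
    ofReal_integral_eq_lintegral_ofReal hint (ae_of_all _ fun τ ↦ sq_nonneg _),
    show (π⁻¹ : ℝ) = (2 * π)⁻¹ * 2 by field_simp, ENNReal.ofReal_mul (by positivity), mul_assoc]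
  gcongr
  calc ∫⁻ τ : ℝ, ENNReal.ofReal (‖mellin (approxC c) (((1 / 2 : ℝ) : ℂ) + τ * I)‖ ^ 2)
      ≤ ∫⁻ τ : ℝ, ENNReal.ofReal 2 *
          (ENNReal.ofReal (jIntegrand ε τ) + ENNReal.ofReal (iIntegrand N ε τ)) := by
        refine lintegral_mono fun τ ↦ ?_
        rw [← ENNReal.ofReal_add (jIntegrand_nonneg ε τ) (iIntegrand_nonneg N ε τ),
          ← ENNReal.ofReal_mul zero_le_two, mul_add]
        exact ENNReal.ofReal_le_ofReal (norm_sq_mellin_approxC_coeff_le N ε τ)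
    _ = ENNReal.ofReal 2 * ((∫⁻ τ : ℝ, ENNReal.ofReal (jIntegrand ε τ)) +
          ∫⁻ τ : ℝ, ENNReal.ofReal (iIntegrand N ε τ)) := by
        rw [lintegral_const_mul' _ _ ENNReal.ofReal_ne_top,
          lintegral_add_left (measurable_jIntegrand ε).ennreal_ofReal]

/-! ## Elementary facts for the assembly -/

/-- With the zero coefficient vector the squared distance is `‖χ‖² = 1`. [folklore] -/
lemma baezDuarteDistSqOf_zero (N : ℕ) : baezDuarteDistSqOf N (fun _ ↦ 0) = 1 := by
  rw [baezDuarteDistSqOf_eq]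
  have h : ∀ x : ℝ, ENNReal.ofReal (((Ioc (0 : ℝ) 1).indicator 1 x -
      ∑ k : Fin N, (0 : ℝ) * Int.fract (1 / (((k : ℕ) + 1 : ℝ) * x))) ^ 2) =
      (Ioc (0 : ℝ) 1).indicator 1 x := by
    intro x
    simp only [zero_mul, Finset.sum_const_zero, sub_zero]
    by_cases hx : x ∈ Ioc (0 : ℝ) 1 <;> simp [hx]
  simp_rw [h]
  rw [lintegral_indicator measurableSet_Ioc]
  simp [Measure.restrict_apply, Ioc_inter_Ioi]

/-- The rate function `(log log N)^{5/2+δ} (log N)^{-1/2}` tends to `0`; more generally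
`A (log log N)^p (log N)^{-1/2} → 0` (`N → ∞`) for all real `A`, `p`. [folklore] -/
lemma tendsto_loglog_rpow_mul_log_rpow (A p : ℝ) :
    Tendsto (fun N : ℕ ↦ A * Real.log (Real.log (N : ℝ)) ^ p * Real.log (N : ℝ) ^ (-(1 / 2 : ℝ)))
      atTop (𝓝 0) := by
  have h1 : Tendsto (fun u : ℝ ↦ Real.log u ^ p * u ^ (-(1 / 2 : ℝ))) atTop (𝓝 0) := by
    have h := (isLittleO_log_rpow_rpow_atTop p (by norm_num : (0 : ℝ) < 1 / 2)).tendsto_div_nhds_zero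
    refine h.congr' ?_
    filter_upwards [eventually_gt_atTop 0] with u hu
    rw [Real.rpow_neg hu.le, div_eq_mul_inv]
  have h2 : Tendsto (fun N : ℕ ↦ Real.log (N : ℝ)) atTop atTop :=
    Real.tendsto_log_atTop.comp tendsto_natCast_atTop_atTop
  have h3 := (h1.comp h2).const_mul A
  rw [mul_zero] at h3
  refine h3.congr fun N ↦ ?_
  simp only [Function.comp_apply, mul_assoc]

/-- `log log 3 > 0` (as `e < 3`). [folklore] -/
lemma log_log_three_pos : 0 < Real.log (Real.log 3) := by
  apply Real.log_pos
  rw [Real.lt_log_iff_exp_lt (by norm_num)]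
  have := Real.exp_one_lt_d9
  linarith

/-- For `3 ≤ N`: `0 < log N` and `log log 3 ≤ log log N`. [folklore] -/
lemma log_log_three_le {N : ℕ} (hN : 3 ≤ N) :
    0 < Real.log (N : ℝ) ∧ Real.log (Real.log 3) ≤ Real.log (Real.log (N : ℝ)) := by
  have hN' : (3 : ℝ) ≤ N := by exact_mod_cast hN
  have hlog3 : 0 < Real.log 3 := Real.log_pos (by norm_num)
  have h1 : Real.log 3 ≤ Real.log (N : ℝ) := Real.log_le_log (by norm_num) hN'
  exact ⟨hlog3.trans_le h1, Real.log_le_log hlog3 h1⟩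

/-- **The choice of `ε` beats `(log N)^{-1/2}`**: if `1 ≤ log log N`, `1 ≤ A (log N)^{1/2}`,
`1 ≤ p` and `ε ≥ A (log log N)^p (log N)^{-1/2}`, then `N^{-ε/2} ≤ (log N)^{-1/2}`
(i.e. `ε log N ≥ log log N`). [cite: BalazardDeRoton2010, §2 (choice of ε, p. 3)] -/
lemma rpow_neg_half_eps_le {N : ℕ} {A p ε : ℝ} (hll : 1 ≤ Real.log (Real.log (N : ℝ)))
    (hA : 1 ≤ A * Real.log (N : ℝ) ^ (1 / 2 : ℝ)) (hp : 1 ≤ p)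
    (hε : A * Real.log (Real.log (N : ℝ)) ^ p * Real.log (N : ℝ) ^ (-(1 / 2 : ℝ)) ≤ ε) :
    (N : ℝ) ^ (-ε / 2) ≤ Real.log (N : ℝ) ^ (-(1 / 2 : ℝ)) := by
  set L := Real.log (N : ℝ) with hL
  set LL := Real.log L with hLL
  have hLnn : 0 ≤ L := by
    rcases Nat.eq_zero_or_pos N with h | h
    · simp [hL, h]
    · exact Real.log_nonneg (by exact_mod_cast h)
  have hL1 : 1 < L := by
    by_contra h
    have : LL ≤ 0 := Real.log_nonpos hLnn (not_lt.mp h)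
    linarith
  have hL0 : 0 < L := by linarith
  have hN0 : (0 : ℝ) < N := by
    rcases Nat.eq_zero_or_pos N with h | h
    · exfalso
      simp [hL, h] at hL1
      linarith
    · exact_mod_cast h
  -- `ε L ≥ LL`
  have hsqrt : L ^ (-(1 / 2 : ℝ)) * L = L ^ (1 / 2 : ℝ) := by
    rw [Real.rpow_neg hL0.le, inv_mul_eq_div, div_eq_iff (Real.rpow_pos_of_pos hL0 _).ne',
      ← Real.rpow_add hL0]
    norm_num
  have hkey : LL ≤ ε * L := by
    have h1 : LL ≤ LL ^ p := by
      conv_lhs => rw [← Real.rpow_one LL]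
      exact Real.rpow_le_rpow_of_exponent_le hll hp
    have h2 : LL ^ p ≤ LL ^ p * (A * L ^ (1 / 2 : ℝ)) :=
      le_mul_of_one_le_right (Real.rpow_nonneg (zero_le_one.trans hll) _) hA
    have h3 : LL ^ p * (A * L ^ (1 / 2 : ℝ)) = (A * LL ^ p * L ^ (-(1 / 2 : ℝ))) * L := by
      rw [← hsqrt]; ring
    calc LL ≤ LL ^ p * (A * L ^ (1 / 2 : ℝ)) := h1.trans h2
      _ = (A * LL ^ p * L ^ (-(1 / 2 : ℝ))) * L := h3
      _ ≤ ε * L := mul_le_mul_of_nonneg_right hε hL0.le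
  rw [Real.rpow_def_of_pos hN0, Real.rpow_def_of_pos hL0, Real.exp_le_exp, ← hL, ← hLL]
  nlinarith

/-- **Small `N`.** The rate function is bounded below on `3 ≤ N ≤ N₁`: there is `m > 0` with
`m ≤ (log log N)^{5/2+δ}(log N)^{-1/2}` there (`δ > 0`). [folklore] -/
lemma exists_pos_le_rate (δ : ℝ) (hδ : 0 < δ) (N₁ : ℕ) : ∃ m : ℝ, 0 < m ∧ ∀ N : ℕ, 3 ≤ N → N ≤ N₁ →
    m ≤ Real.log (Real.log (N : ℝ)) ^ (5 / 2 + δ) * Real.log (N : ℝ) ^ (-(1 / 2 : ℝ)) := by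
  set q : ℝ := 5 / 2 + δ with hq
  have hq0 : 0 ≤ q := by rw [hq]; linarith
  set m₁ : ℝ := min 1 (Real.log (Real.log 3) ^ q) with hm₁
  have hm₁0 : 0 < m₁ := lt_min zero_lt_one (Real.rpow_pos_of_pos log_log_three_pos _)
  set L₁ : ℝ := max (Real.log (N₁ : ℝ)) 1 with hL₁
  have hL₁0 : 0 < L₁ := lt_max_of_lt_right zero_lt_one
  refine ⟨m₁ * L₁ ^ (-(1 / 2 : ℝ)), mul_pos hm₁0 (Real.rpow_pos_of_pos hL₁0 _), fun N h3 hN₁ ↦ ?_⟩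
  obtain ⟨hL0, hll⟩ := log_log_three_le h3
  refine mul_le_mul ?_ ?_ (Real.rpow_nonneg hL₁0.le _)
    (Real.rpow_nonneg (log_log_three_pos.le.trans hll) _)
  · -- `(log log N)^q ≥ min 1 (log log 3)^q`
    rcases le_or_gt 1 (Real.log (Real.log (N : ℝ))) with h | h
    · exact (min_le_left _ _).trans (Real.one_le_rpow h hq0)
    · exact (min_le_right _ _).trans (Real.rpow_le_rpow log_log_three_pos.le hll hq0)
  · -- `(log N)^{-1/2} ≥ L₁^{-1/2}`
    refine Real.rpow_le_rpow_of_nonpos hL0 ?_ (by norm_num)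
    exact (Real.log_le_log (by exact_mod_cast (show 0 < N by omega))
      (by exact_mod_cast hN₁)).trans (le_max_left _ _)

/-! ## The assembly: Théorème 1 from Propositions 2 and 3 -/

/-- **Large `N`** (Balazard–de Roton 2010, p. 3: "Le choix `ε = 25(log log N)^{5/2+δ}(log N)^{-1/2}`
donne le théorème"): if `∫ jIntegrand ε ≤ C₁ ε` for `0 < ε ≤ ε₁` (Proposition 2) and
`∫ iIntegrand N ε ≤ C₂ N^{-ε/2}` for `N ≥ N₀`, `A(log log N)^{5/2+δ}(log N)^{-1/2} ≤ ε ≤ ε₂`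
(Proposition 3), then for all large `N` (in particular `log log N ≥ 1`) the vector
`c = coeff (ε_N/2) N`, `ε_N = A(log log N)^{5/2+δ}(log N)^{-1/2}`, achieves
`d_N² ≤ ‖χ - ∑ c_k e_{k+1}‖² ≤ B (log log N)^{5/2+δ}(log N)^{-1/2}` with `B = A C₁⁺ + C₂⁺`
(Proposition 1, `π⁻¹ ≤ 1`, and `N^{-ε_N/2} ≤ (log N)^{-1/2}`).
[cite: BalazardDeRoton2010, Théorème 1 (proof, p. 3)] -/
theorem exists_bound_of_props {δ C₁ ε₁ A C₂ ε₂ : ℝ} {N₀ : ℕ} (hδ : 0 < δ) (hε₁ : 0 < ε₁)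
    (hJ : ∀ ε : ℝ, 0 < ε → ε ≤ ε₁ →
      ∫⁻ τ, ENNReal.ofReal (jIntegrand ε τ) ≤ ENNReal.ofReal (C₁ * ε))
    (hA : 0 < A) (hε₂ : 0 < ε₂)
    (hI : ∀ N : ℕ, N₀ ≤ N → ∀ ε : ℝ,
      A * Real.log (Real.log (N : ℝ)) ^ (5 / 2 + δ) * Real.log (N : ℝ) ^ (-(1 / 2 : ℝ)) ≤ ε →
        ε ≤ ε₂ →
        ∫⁻ τ, ENNReal.ofReal (iIntegrand N ε τ) ≤ ENNReal.ofReal (C₂ * (N : ℝ) ^ (-ε / 2))) :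
    ∃ (B : ℝ) (N₁ : ℕ), 0 ≤ B ∧ ∀ N : ℕ, N₁ ≤ N →
      1 ≤ Real.log (Real.log (N : ℝ)) ∧ ∃ c : Fin N → ℝ,
        baezDuarteDistSqOf N c ≤ ENNReal.ofReal
          (B * Real.log (Real.log (N : ℝ)) ^ (5 / 2 + δ) * Real.log (N : ℝ) ^ (-(1 / 2 : ℝ))) := by
  set p : ℝ := 5 / 2 + δ with hp
  have hp1 : 1 ≤ p := by rw [hp]; linarith
  set εN : ℕ → ℝ := fun N ↦
    A * Real.log (Real.log (N : ℝ)) ^ p * Real.log (N : ℝ) ^ (-(1 / 2 : ℝ)) with hεN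
  set C₁' : ℝ := max C₁ 0 with hC₁'
  set C₂' : ℝ := max C₂ 0 with hC₂'
  -- the eventual conditions on `N`
  have hlog : Tendsto (fun N : ℕ ↦ Real.log (N : ℝ)) atTop atTop :=
    Real.tendsto_log_atTop.comp tendsto_natCast_atTop_atTop
  have ev1 : ∀ᶠ N : ℕ in atTop, N₀ ≤ N := eventually_ge_atTop N₀
  have ev2 : ∀ᶠ N : ℕ in atTop, εN N ≤ min ε₁ ε₂ :=
    (tendsto_loglog_rpow_mul_log_rpow A p).eventually_le_const (lt_min hε₁ hε₂)
  have ev3 : ∀ᶠ N : ℕ in atTop, 1 ≤ Real.log (Real.log (N : ℝ)) :=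
    (Real.tendsto_log_atTop.comp hlog).eventually_ge_atTop 1
  have ev4 : ∀ᶠ N : ℕ in atTop, 1 ≤ A * Real.log (N : ℝ) ^ (1 / 2 : ℝ) :=
    (((tendsto_rpow_atTop (by norm_num : (0 : ℝ) < 1 / 2)).comp hlog).const_mul_atTop hA
      ).eventually_ge_atTop 1
  obtain ⟨N₁, hN₁⟩ := eventually_atTop.mp (ev1.and (ev2.and (ev3.and ev4)))
  refine ⟨C₁' * A + C₂', N₁, by positivity, fun N hN ↦ ?_⟩
  obtain ⟨h1, h2, h3, h4⟩ := hN₁ N hN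
  refine ⟨h3, coeff (εN N / 2) N, ?_⟩
  set L := Real.log (N : ℝ) with hL
  set LL := Real.log L with hLL
  have hLL0 : 0 < LL := zero_lt_one.trans_le h3
  have hLLp : 1 ≤ LL ^ p := Real.one_le_rpow h3 (zero_le_one.trans hp1)
  have hL0 : 0 < L := by
    by_contra h
    have : LL ≤ 0 := by
      rw [hLL]
      exact Real.log_nonpos (by
        rcases Nat.eq_zero_or_pos N with h' | h'
        · simp [hL, h']
        · exact Real.log_nonneg (by exact_mod_cast h')) (by linarith)
    linarith
  have hε0 : 0 < εN N := by
    simp only [hεN]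
    exact mul_pos (mul_pos hA (Real.rpow_pos_of_pos hLL0 _)) (Real.rpow_pos_of_pos hL0 _)
  have hεle₁ : εN N ≤ ε₁ := h2.trans (min_le_left _ _)
  have hεle₂ : εN N ≤ ε₂ := h2.trans (min_le_right _ _)
  -- Propositions 2 and 3 at `ε = ε_N`
  have hJ' : ∫⁻ τ, ENNReal.ofReal (jIntegrand (εN N) τ) ≤ ENNReal.ofReal (C₁' * εN N) :=
    (hJ _ hε0 hεle₁).trans (ENNReal.ofReal_le_ofReal
      (mul_le_mul_of_nonneg_right (le_max_left _ _) hε0.le))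
  have hI' : ∫⁻ τ, ENNReal.ofReal (iIntegrand N (εN N) τ) ≤
      ENNReal.ofReal (C₂' * (N : ℝ) ^ (-εN N / 2)) :=
    (hI N h1 _ le_rfl hεle₂).trans (ENNReal.ofReal_le_ofReal
      (mul_le_mul_of_nonneg_right (le_max_left _ _) (Real.rpow_nonneg (Nat.cast_nonneg N) _)))
  -- `N^{-ε_N/2} ≤ (log N)^{-1/2} ≤ (log log N)^p (log N)^{-1/2}`
  have hdecay : (N : ℝ) ^ (-εN N / 2) ≤ LL ^ p * L ^ (-(1 / 2 : ℝ)) :=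
    (rpow_neg_half_eps_le h3 h4 hp1 le_rfl).trans
      (le_mul_of_one_le_left (Real.rpow_nonneg hL0.le _) hLLp)
  have hreal : π⁻¹ * (C₁' * εN N + C₂' * (N : ℝ) ^ (-εN N / 2)) ≤
      (C₁' * A + C₂') * LL ^ p * L ^ (-(1 / 2 : ℝ)) := by
    have hπ : (π : ℝ)⁻¹ ≤ 1 := inv_le_one_of_one_le₀ (by linarith [Real.pi_gt_three])
    have hC₁'0 : 0 ≤ C₁' := le_max_right _ _
    have hC₂'0 : 0 ≤ C₂' := le_max_right _ _
    have hsum0 : 0 ≤ C₁' * εN N + C₂' * (N : ℝ) ^ (-εN N / 2) := by positivity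
    calc π⁻¹ * (C₁' * εN N + C₂' * (N : ℝ) ^ (-εN N / 2))
        ≤ 1 * (C₁' * εN N + C₂' * (N : ℝ) ^ (-εN N / 2)) :=
          mul_le_mul_of_nonneg_right hπ hsum0
      _ ≤ C₁' * εN N + C₂' * (LL ^ p * L ^ (-(1 / 2 : ℝ))) := by
          rw [one_mul]; gcongr
      _ = (C₁' * A + C₂') * LL ^ p * L ^ (-(1 / 2 : ℝ)) := by simp only [hεN]; ring
  calc baezDuarteDistSqOf N (coeff (εN N / 2) N)
      ≤ ENNReal.ofReal (π⁻¹) * ((∫⁻ τ : ℝ, ENNReal.ofReal (jIntegrand (εN N) τ)) +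
          ∫⁻ τ : ℝ, ENNReal.ofReal (iIntegrand N (εN N) τ)) := baezDuarteDistSqOf_coeff_le N _
    _ ≤ ENNReal.ofReal (π⁻¹) * (ENNReal.ofReal (C₁' * εN N) +
          ENNReal.ofReal (C₂' * (N : ℝ) ^ (-εN N / 2))) := by gcongr
    _ = ENNReal.ofReal (π⁻¹ * (C₁' * εN N + C₂' * (N : ℝ) ^ (-εN N / 2))) := by
        rw [← ENNReal.ofReal_add (by positivity) (by positivity),
          ← ENNReal.ofReal_mul (by positivity)]
    _ ≤ _ := ENNReal.ofReal_le_ofReal hreal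

end BalazardDeRoton

open BalazardDeRoton BaezDuarteOnlyIf in
/-- **Balazard–de Roton 2010, Théorème 1, from Propositions 2 and 3.** If, under RH,
(Prop. 2) `∫ |1 - ζ(s)/ζ(s+ε)|² dτ/|s|² ≤ C₁ ε` for `0 < ε ≤ ε₁`, and (Prop. 3) for every
`0 < δ ≤ 1/2` there are `A, C₂, ε₂ > 0`, `N₀` with
`∫ |ζ(s)|²|M_N(s+ε) - ζ(s+ε)⁻¹|² dτ/|s|² ≤ C₂ N^{-ε/2}` whenever `N ≥ N₀` and
`A(log log N)^{5/2+δ}(log N)^{-1/2} ≤ ε ≤ ε₂` (`s = 1/2+iτ`; the paper has `A = 25`), then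
`BalazardDeRoton2010_thm1`: for every `δ > 0` there is `C` with
`d_N² ≤ C(log log N)^{5/2+δ}(log N)^{-1/2}` for all `N ≥ 3`, with an attained coefficient vector.
Proof: Proposition 1 and `exists_bound_of_props` at `δ' = min δ 1/2` for large `N`
(`(log log N)^{5/2+δ'} ≤ (log log N)^{5/2+δ}` once `log log N ≥ 1`); for the finitely many
remaining `N ≥ 3`, `d_N² ≤ ‖χ‖² = 1` (`c = 0`) and the rate function is bounded below
(`exists_pos_le_rate`). [cite: BalazardDeRoton2010, Théorème 1 (proof, pp. 2–3)] -/
theorem BalazardDeRoton2010_thm1_of_props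
    (hJ : RiemannHypothesis → ∃ C₁ ε₁ : ℝ, 0 < ε₁ ∧ ∀ ε : ℝ, 0 < ε → ε ≤ ε₁ →
      ∫⁻ τ, ENNReal.ofReal (jIntegrand ε τ) ≤ ENNReal.ofReal (C₁ * ε))
    (hI : RiemannHypothesis → ∀ δ : ℝ, 0 < δ → δ ≤ 1 / 2 →
      ∃ (A C₂ ε₂ : ℝ) (N₀ : ℕ), 0 < A ∧ 0 < ε₂ ∧ ∀ N : ℕ, N₀ ≤ N → ∀ ε : ℝ,
        A * Real.log (Real.log (N : ℝ)) ^ (5 / 2 + δ) * Real.log (N : ℝ) ^ (-(1 / 2 : ℝ)) ≤ ε →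
          ε ≤ ε₂ →
          ∫⁻ τ, ENNReal.ofReal (iIntegrand N ε τ) ≤ ENNReal.ofReal (C₂ * (N : ℝ) ^ (-ε / 2))) :
    BalazardDeRoton2010_thm1 := by
  intro hRH δ hδ
  set δ' : ℝ := min δ (1 / 2) with hδ'
  have hδ'0 : 0 < δ' := lt_min hδ one_half_pos
  obtain ⟨C₁, ε₁, hε₁, hJ'⟩ := hJ hRH
  obtain ⟨A, C₂, ε₂, N₀, hA, hε₂, hI'⟩ := hI hRH δ' hδ'0 (min_le_right _ _)
  obtain ⟨B, N₁, hB, hlarge⟩ := exists_bound_of_props hδ'0 hε₁ hJ' hA hε₂ hI'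
  obtain ⟨m, hm, hsmall⟩ := exists_pos_le_rate δ hδ N₁
  refine ⟨max B m⁻¹, fun N hN3 ↦ ?_⟩
  set L := Real.log (N : ℝ) with hL
  set LL := Real.log L with hLL
  have hL0 : 0 < L := (log_log_three_le hN3).1
  have hrate0 : 0 ≤ LL ^ (5 / 2 + δ) * L ^ (-(1 / 2 : ℝ)) :=
    mul_nonneg (Real.rpow_nonneg (log_log_three_pos.le.trans (log_log_three_le hN3).2) _)
      (Real.rpow_nonneg hL0.le _)
  rcases le_or_gt N₁ N with hN | hN
  · -- large `N`
    obtain ⟨hll, c, hc⟩ := hlarge N hN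
    refine ⟨c, hc.trans (ENNReal.ofReal_le_ofReal ?_)⟩
    have hexp : LL ^ (5 / 2 + δ') ≤ LL ^ (5 / 2 + δ) :=
      Real.rpow_le_rpow_of_exponent_le hll (by linarith [min_le_left δ (1 / 2)])
    calc B * LL ^ (5 / 2 + δ') * L ^ (-(1 / 2 : ℝ))
        ≤ B * LL ^ (5 / 2 + δ) * L ^ (-(1 / 2 : ℝ)) := by gcongr
      _ = B * (LL ^ (5 / 2 + δ) * L ^ (-(1 / 2 : ℝ))) := by ring
      _ ≤ max B m⁻¹ * (LL ^ (5 / 2 + δ) * L ^ (-(1 / 2 : ℝ))) :=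
          mul_le_mul_of_nonneg_right (le_max_left _ _) hrate0
      _ = _ := by ring
  · -- small `N`: `d_N² ≤ 1`
    refine ⟨fun _ ↦ 0, ?_⟩
    rw [baezDuarteDistSqOf_zero, ← ENNReal.ofReal_one]
    refine ENNReal.ofReal_le_ofReal ?_
    have h := hsmall N hN3 hN.le
    calc (1 : ℝ) = m⁻¹ * m := by field_simp
      _ ≤ max B m⁻¹ * (LL ^ (5 / 2 + δ) * L ^ (-(1 / 2 : ℝ))) :=
          mul_le_mul (le_max_right _ _) h hm.le (le_trans (inv_nonneg.mpr hm.le) (le_max_right _ _))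
      _ = _ := by ring


end Literature.NumberTheory.LFunctions

end
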